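import Summits.AtomisticToContinuum.Crystallization.Theorems.FrustratedLawDichotomyTwoShellRigidityPatternGram
import Summits.AtomisticToContinuum.Crystallization.Theorems.FrustratedLawDichotomyTwoShellRigidityPlacement

/-!
# FrustratedLawDichotomy · two-shell rigidity — the HCP FRAME ASSEMBLY (sequential placement walk), `FrameAssemblyAt` for hcp

The pattern walk of the frame assembly for `hcpKissingPattern` (lens-5 g30 piece `FrameAssemblyAt K c`, the last open piece of
`R = CoarseCappedRigidity`): seed = one link square fitted by its cell isometry `A`; every further vertex by ONE application of
`…TwoShellRigidityPlacement.placement_step` (two anchors at 60°/90°, in-plane coefficients `(p,q) ∈ {(1/3,1/3),(−1/3,2/3),(2/3,−1/3),(1/2,1/2)}`,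
mirror image excluded by an already placed NON-contact at mirror distance `√(1/3)` or `0`); ℓ¹ error bookkeeping `E_x = c + L(E+c)`:
with `c = 18`: `18 → 150 → 690` (worst), valid while `(c + L(E+c) + E)·θ < 2/5`, i.e. `θ ≤ 1/2200`.  Above `1/2200` the assembly is
trivial (`…AssemblyDial.frameAssemblyAt_hcp_of_smallAngle`), whence `FrameAssemblyAt 4796 18 hcpKissingPattern`.
All Gram data are read off the integer model by `decide` (`…PatternGram`).  No `sorry`, no defs.
-/

noncomputable section

namespace Summit.AtomisticToContinuum.Crystallization.Theorems.FrustratedLawDichotomyTwoShellRigidityHcpWalk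

open Literature.Geometry.DiscreteGeometry
open Literature.Geometry.DiscreteGeometry.ShellCensus
open Summit.AtomisticToContinuum.Crystallization.Theorems.FrustratedLawDichotomyTwoShellRigidityCut (E3)
open Summit.AtomisticToContinuum.Crystallization.Theorems.FrustratedLawDichotomyTwoShellRigidityCells
open Summit.AtomisticToContinuum.Crystallization.Theorems.FrustratedLawDichotomyTwoShellRigidityAssemblyDial
open Summit.AtomisticToContinuum.Crystallization.Theorems.FrustratedLawDichotomyTwoShellRigidityPatternGram
open Summit.AtomisticToContinuum.Crystallization.Theorems.FrustratedLawDichotomyTwoShellRigidityPlacement (placement_step)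
open scoped RealInnerProductSpace

set_option maxHeartbeats 800000 in
/-- **The hcp walk at scale `1`**: for `0 < θ ≤ 1/2200`, cell fits within `18·θ` and non-contacts `≥ 1` apart ⟹ one linear isometry fits
all twelve points within `690·θ`. [folklore] -/
theorem hcp_walk_unit {θ : ℝ} (hθ0 : 0 < θ) (hθ1 : θ ≤ 1 / 2200) (p : ↥hcpKissingPattern → E3)
    (hT : ∀ u w x : ↥hcpKissingPattern, dist (u : E3) (w : E3) = 1 → dist (w : E3) (x : E3) = 1 → dist (u : E3) (x : E3) = 1 →
        ∃ A : E3 →ₗᵢ[ℝ] E3, ∀ z : ↥hcpKissingPattern, z = u ∨ z = w ∨ z = x → ‖p z - A (z : E3)‖ ≤ 18 * θ)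
    (hO : ∀ u v w w' : ↥hcpKissingPattern, dist (u : E3) (v : E3) = Real.sqrt 2 → dist (w : E3) (u : E3) = 1 →
        dist (w : E3) (v : E3) = 1 → dist (w' : E3) (u : E3) = 1 → dist (w' : E3) (v : E3) = 1 →
        dist (w : E3) (w' : E3) = Real.sqrt 2 →
        ∃ A : E3 →ₗᵢ[ℝ] E3, ∀ z : ↥hcpKissingPattern, z = u ∨ z = v ∨ z = w ∨ z = w' → ‖p z - A (z : E3)‖ ≤ 18 * θ)
    (hN : ∀ u v : ↥hcpKissingPattern, u ≠ v → dist (u : E3) (v : E3) ≠ 1 → 1 ≤ dist (p u) (p v)) :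
    ∃ A : E3 →ₗᵢ[ℝ] E3, ∀ z : ↥hcpKissingPattern, ‖p z - A (z : E3)‖ ≤ 690 * θ := by
  have hV : Module.finrank ℝ E3 = 3 := finrank_euclideanSpace_fin
  have n1 : ∀ k : Fin 12, ‖hcpTuple k‖ = 1 := fun k => norm_eq_one_of_mem_hcpKissingPattern (hcpTuple_mem k)
  have weak : ∀ {v : E3} {a b : ℝ}, ‖v‖ ≤ a * θ → a ≤ b → ‖v‖ ≤ b * θ :=
    fun h hab => h.trans (mul_le_mul_of_nonneg_right hab hθ0.le)
  have hNd : ∀ {j k : Fin 12}, j ≠ k → sqNormInt (hcpVec j - hcpVec k) ≠ 18 →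
      1 ≤ ‖p ⟨hcpTuple j, hcpTuple_mem j⟩ - p ⟨hcpTuple k, hcpTuple_mem k⟩‖ := by
    intro j k hjk hne
    have h := hN ⟨hcpTuple j, hcpTuple_mem j⟩ ⟨hcpTuple k, hcpTuple_mem k⟩ (fun e => hcpTuple_ne hjk (congrArg Subtype.val e)) (dist_hcpTuple_ne_one hne)
    rwa [dist_eq_norm] at h
  -- seed: the link square {0,6,2,7}
  obtain ⟨A, hA⟩ := hO ⟨hcpTuple 0, hcpTuple_mem 0⟩ ⟨hcpTuple 6, hcpTuple_mem 6⟩ ⟨hcpTuple 2, hcpTuple_mem 2⟩ ⟨hcpTuple 7, hcpTuple_mem 7⟩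
    (dist_hcpTuple_eq_sqrt_two (by decide : sqNormInt (hcpVec 0 - hcpVec 6) = 36)) (dist_hcpTuple_eq_one (by decide : sqNormInt (hcpVec 2 - hcpVec 0) = 18)) (dist_hcpTuple_eq_one (by decide : sqNormInt (hcpVec 2 - hcpVec 6) = 18)) (dist_hcpTuple_eq_one (by decide : sqNormInt (hcpVec 7 - hcpVec 0) = 18)) (dist_hcpTuple_eq_one (by decide : sqNormInt (hcpVec 7 - hcpVec 6) = 18)) (dist_hcpTuple_eq_sqrt_two (by decide : sqNormInt (hcpVec 2 - hcpVec 7) = 36))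
  have f0 : ‖p ⟨hcpTuple 0, hcpTuple_mem 0⟩ - A (hcpTuple 0)‖ ≤ 18 * θ := hA _ (Or.inl rfl)
  have f6 : ‖p ⟨hcpTuple 6, hcpTuple_mem 6⟩ - A (hcpTuple 6)‖ ≤ 18 * θ := hA _ (Or.inr (Or.inl rfl))
  have f2 : ‖p ⟨hcpTuple 2, hcpTuple_mem 2⟩ - A (hcpTuple 2)‖ ≤ 18 * θ := hA _ (Or.inr (Or.inr (Or.inl rfl)))
  have f7 : ‖p ⟨hcpTuple 7, hcpTuple_mem 7⟩ - A (hcpTuple 7)‖ ≤ 18 * θ := hA _ (Or.inr (Or.inr (Or.inr rfl)))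
  -- step 1: triangle {0,5,7}, new vertex 5, anchors 0 7, witness 2 (E = 18)
  obtain ⟨A1, hA1⟩ := hT ⟨hcpTuple 0, hcpTuple_mem 0⟩ ⟨hcpTuple 5, hcpTuple_mem 5⟩ ⟨hcpTuple 7, hcpTuple_mem 7⟩ (dist_hcpTuple_eq_one (by decide : sqNormInt (hcpVec 0 - hcpVec 5) = 18)) (dist_hcpTuple_eq_one (by decide : sqNormInt (hcpVec 5 - hcpVec 7) = 18)) (dist_hcpTuple_eq_one (by decide : sqNormInt (hcpVec 0 - hcpVec 7) = 18))
  have f5 : ‖p ⟨hcpTuple 5, hcpTuple_mem 5⟩ - A (hcpTuple 5)‖ ≤ 150 * θ := by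
    have h := placement_step hV A A1 (z₀ := hcpTuple 0) (z₁ := hcpTuple 7) (x := hcpTuple 5) (y := hcpTuple 2)
      (X := p ⟨hcpTuple 5, hcpTuple_mem 5⟩) (Y := p ⟨hcpTuple 2, hcpTuple_mem 2⟩) (P₀ := p ⟨hcpTuple 0, hcpTuple_mem 0⟩) (P₁ := p ⟨hcpTuple 7, hcpTuple_mem 7⟩)
      (κ := 1 / 2) (p := 1 / 3) (q := 1 / 3) (L := 11 / 3) (E := 18) (c := 18) (θ := θ)
      (n1 0) (n1 7) (n1 5) (n1 2)
      (by rw [inner_hcpTuple 0 7, (by decide : sqNormInt (hcpVec 0 - hcpVec 7) = 18)]; norm_num)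
      (by norm_num)
      (by rw [inner_hcpTuple 5 0, (by decide : sqNormInt (hcpVec 5 - hcpVec 0) = 18)]; norm_num)
      (by rw [inner_hcpTuple 5 7, (by decide : sqNormInt (hcpVec 5 - hcpVec 7) = 18)]; norm_num)
      (by norm_num)
      (by rw [inner_hcpTuple 5 2, inner_hcpTuple 2 0, inner_hcpTuple 2 7, (by decide : sqNormInt (hcpVec 5 - hcpVec 2) = 54), (by decide : sqNormInt (hcpVec 2 - hcpVec 0) = 18), (by decide : sqNormInt (hcpVec 2 - hcpVec 7) = 36)]; norm_num)
      hθ0.le (by norm_num) (by norm_num) (by linarith)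
      f0 f7 f2
      (hA1 _ (Or.inl rfl)) (hA1 _ (Or.inr (Or.inr rfl))) (hA1 _ (Or.inr (Or.inl rfl)))
      (hNd (by decide : (5 : Fin 12) ≠ 2) (by decide))
    exact h.trans (le_of_eq (by norm_num))
  -- step 2: triangle {2,4,6}, new vertex 4, anchors 2 6, witness 0 (E = 18)
  obtain ⟨A2, hA2⟩ := hT ⟨hcpTuple 2, hcpTuple_mem 2⟩ ⟨hcpTuple 4, hcpTuple_mem 4⟩ ⟨hcpTuple 6, hcpTuple_mem 6⟩ (dist_hcpTuple_eq_one (by decide : sqNormInt (hcpVec 2 - hcpVec 4) = 18)) (dist_hcpTuple_eq_one (by decide : sqNormInt (hcpVec 4 - hcpVec 6) = 18)) (dist_hcpTuple_eq_one (by decide : sqNormInt (hcpVec 2 - hcpVec 6) = 18))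
  have f4 : ‖p ⟨hcpTuple 4, hcpTuple_mem 4⟩ - A (hcpTuple 4)‖ ≤ 150 * θ := by
    have h := placement_step hV A A2 (z₀ := hcpTuple 2) (z₁ := hcpTuple 6) (x := hcpTuple 4) (y := hcpTuple 0)
      (X := p ⟨hcpTuple 4, hcpTuple_mem 4⟩) (Y := p ⟨hcpTuple 0, hcpTuple_mem 0⟩) (P₀ := p ⟨hcpTuple 2, hcpTuple_mem 2⟩) (P₁ := p ⟨hcpTuple 6, hcpTuple_mem 6⟩)
      (κ := 1 / 2) (p := 1 / 3) (q := 1 / 3) (L := 11 / 3) (E := 18) (c := 18) (θ := θ)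
      (n1 2) (n1 6) (n1 4) (n1 0)
      (by rw [inner_hcpTuple 2 6, (by decide : sqNormInt (hcpVec 2 - hcpVec 6) = 18)]; norm_num)
      (by norm_num)
      (by rw [inner_hcpTuple 4 2, (by decide : sqNormInt (hcpVec 4 - hcpVec 2) = 18)]; norm_num)
      (by rw [inner_hcpTuple 4 6, (by decide : sqNormInt (hcpVec 4 - hcpVec 6) = 18)]; norm_num)
      (by norm_num)
      (by rw [inner_hcpTuple 4 0, inner_hcpTuple 0 2, inner_hcpTuple 0 6, (by decide : sqNormInt (hcpVec 4 - hcpVec 0) = 54), (by decide : sqNormInt (hcpVec 0 - hcpVec 2) = 18), (by decide : sqNormInt (hcpVec 0 - hcpVec 6) = 36)]; norm_num)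
      hθ0.le (by norm_num) (by norm_num) (by linarith)
      f2 f6 f0
      (hA2 _ (Or.inl rfl)) (hA2 _ (Or.inr (Or.inr rfl))) (hA2 _ (Or.inr (Or.inl rfl)))
      (hNd (by decide : (4 : Fin 12) ≠ 0) (by decide))
    exact h.trans (le_of_eq (by norm_num))
  -- step 3: triangle {6,7,8}, new vertex 8, anchors 6 7, witness 0 (E = 18)
  obtain ⟨A3, hA3⟩ := hT ⟨hcpTuple 6, hcpTuple_mem 6⟩ ⟨hcpTuple 7, hcpTuple_mem 7⟩ ⟨hcpTuple 8, hcpTuple_mem 8⟩ (dist_hcpTuple_eq_one (by decide : sqNormInt (hcpVec 6 - hcpVec 7) = 18)) (dist_hcpTuple_eq_one (by decide : sqNormInt (hcpVec 7 - hcpVec 8) = 18)) (dist_hcpTuple_eq_one (by decide : sqNormInt (hcpVec 6 - hcpVec 8) = 18))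
  have f8 : ‖p ⟨hcpTuple 8, hcpTuple_mem 8⟩ - A (hcpTuple 8)‖ ≤ 150 * θ := by
    have h := placement_step hV A A3 (z₀ := hcpTuple 6) (z₁ := hcpTuple 7) (x := hcpTuple 8) (y := hcpTuple 0)
      (X := p ⟨hcpTuple 8, hcpTuple_mem 8⟩) (Y := p ⟨hcpTuple 0, hcpTuple_mem 0⟩) (P₀ := p ⟨hcpTuple 6, hcpTuple_mem 6⟩) (P₁ := p ⟨hcpTuple 7, hcpTuple_mem 7⟩)
      (κ := 1 / 2) (p := 1 / 3) (q := 1 / 3) (L := 11 / 3) (E := 18) (c := 18) (θ := θ)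
      (n1 6) (n1 7) (n1 8) (n1 0)
      (by rw [inner_hcpTuple 6 7, (by decide : sqNormInt (hcpVec 6 - hcpVec 7) = 18)]; norm_num)
      (by norm_num)
      (by rw [inner_hcpTuple 8 6, (by decide : sqNormInt (hcpVec 8 - hcpVec 6) = 18)]; norm_num)
      (by rw [inner_hcpTuple 8 7, (by decide : sqNormInt (hcpVec 8 - hcpVec 7) = 18)]; norm_num)
      (by norm_num)
      (by rw [inner_hcpTuple 8 0, inner_hcpTuple 0 6, inner_hcpTuple 0 7, (by decide : sqNormInt (hcpVec 8 - hcpVec 0) = 54), (by decide : sqNormInt (hcpVec 0 - hcpVec 6) = 36), (by decide : sqNormInt (hcpVec 0 - hcpVec 7) = 18)]; norm_num)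
      hθ0.le (by norm_num) (by norm_num) (by linarith)
      f6 f7 f0
      (hA3 _ (Or.inl rfl)) (hA3 _ (Or.inr (Or.inl rfl))) (hA3 _ (Or.inr (Or.inr rfl)))
      (hNd (by decide : (8 : Fin 12) ≠ 0) (by decide))
    exact h.trans (le_of_eq (by norm_num))
  -- step 4: square {0,9,2,10}, new vertex 9, anchors 0 2, witness 6 (E = 18)
  obtain ⟨A4, hA4⟩ := hO ⟨hcpTuple 0, hcpTuple_mem 0⟩ ⟨hcpTuple 9, hcpTuple_mem 9⟩ ⟨hcpTuple 2, hcpTuple_mem 2⟩ ⟨hcpTuple 10, hcpTuple_mem 10⟩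
    (dist_hcpTuple_eq_sqrt_two (by decide : sqNormInt (hcpVec 0 - hcpVec 9) = 36)) (dist_hcpTuple_eq_one (by decide : sqNormInt (hcpVec 2 - hcpVec 0) = 18)) (dist_hcpTuple_eq_one (by decide : sqNormInt (hcpVec 2 - hcpVec 9) = 18)) (dist_hcpTuple_eq_one (by decide : sqNormInt (hcpVec 10 - hcpVec 0) = 18)) (dist_hcpTuple_eq_one (by decide : sqNormInt (hcpVec 10 - hcpVec 9) = 18)) (dist_hcpTuple_eq_sqrt_two (by decide : sqNormInt (hcpVec 2 - hcpVec 10) = 36))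
  have f9 : ‖p ⟨hcpTuple 9, hcpTuple_mem 9⟩ - A (hcpTuple 9)‖ ≤ 162 * θ := by
    have h := placement_step hV A A4 (z₀ := hcpTuple 0) (z₁ := hcpTuple 2) (x := hcpTuple 9) (y := hcpTuple 6)
      (X := p ⟨hcpTuple 9, hcpTuple_mem 9⟩) (Y := p ⟨hcpTuple 6, hcpTuple_mem 6⟩) (P₀ := p ⟨hcpTuple 0, hcpTuple_mem 0⟩) (P₁ := p ⟨hcpTuple 2, hcpTuple_mem 2⟩)
      (κ := 1 / 2) (p := (-(1 / 3))) (q := 2 / 3) (L := 4) (E := 18) (c := 18) (θ := θ)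
      (n1 0) (n1 2) (n1 9) (n1 6)
      (by rw [inner_hcpTuple 0 2, (by decide : sqNormInt (hcpVec 0 - hcpVec 2) = 18)]; norm_num)
      (by norm_num)
      (by rw [inner_hcpTuple 9 0, (by decide : sqNormInt (hcpVec 9 - hcpVec 0) = 36)]; norm_num)
      (by rw [inner_hcpTuple 9 2, (by decide : sqNormInt (hcpVec 9 - hcpVec 2) = 18)]; norm_num)
      (by norm_num)
      (by rw [inner_hcpTuple 9 6, inner_hcpTuple 6 0, inner_hcpTuple 6 2, (by decide : sqNormInt (hcpVec 9 - hcpVec 6) = 48), (by decide : sqNormInt (hcpVec 6 - hcpVec 0) = 36), (by decide : sqNormInt (hcpVec 6 - hcpVec 2) = 18)]; norm_num)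
      hθ0.le (by norm_num) (by norm_num) (by linarith)
      f0 f2 f6
      (hA4 _ (Or.inl rfl)) (hA4 _ (Or.inr (Or.inr (Or.inl rfl)))) (hA4 _ (Or.inr (Or.inl rfl)))
      (hNd (by decide : (9 : Fin 12) ≠ 6) (by decide))
    exact h.trans (le_of_eq (by norm_num))
  -- step 5: square {0,9,2,10}, new vertex 10, anchors 0 2, witness 7 (E = 18)
  obtain ⟨A5, hA5⟩ := hO ⟨hcpTuple 0, hcpTuple_mem 0⟩ ⟨hcpTuple 9, hcpTuple_mem 9⟩ ⟨hcpTuple 2, hcpTuple_mem 2⟩ ⟨hcpTuple 10, hcpTuple_mem 10⟩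
    (dist_hcpTuple_eq_sqrt_two (by decide : sqNormInt (hcpVec 0 - hcpVec 9) = 36)) (dist_hcpTuple_eq_one (by decide : sqNormInt (hcpVec 2 - hcpVec 0) = 18)) (dist_hcpTuple_eq_one (by decide : sqNormInt (hcpVec 2 - hcpVec 9) = 18)) (dist_hcpTuple_eq_one (by decide : sqNormInt (hcpVec 10 - hcpVec 0) = 18)) (dist_hcpTuple_eq_one (by decide : sqNormInt (hcpVec 10 - hcpVec 9) = 18)) (dist_hcpTuple_eq_sqrt_two (by decide : sqNormInt (hcpVec 2 - hcpVec 10) = 36))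
  have f10 : ‖p ⟨hcpTuple 10, hcpTuple_mem 10⟩ - A (hcpTuple 10)‖ ≤ 162 * θ := by
    have h := placement_step hV A A5 (z₀ := hcpTuple 0) (z₁ := hcpTuple 2) (x := hcpTuple 10) (y := hcpTuple 7)
      (X := p ⟨hcpTuple 10, hcpTuple_mem 10⟩) (Y := p ⟨hcpTuple 7, hcpTuple_mem 7⟩) (P₀ := p ⟨hcpTuple 0, hcpTuple_mem 0⟩) (P₁ := p ⟨hcpTuple 2, hcpTuple_mem 2⟩)
      (κ := 1 / 2) (p := 2 / 3) (q := (-(1 / 3))) (L := 4) (E := 18) (c := 18) (θ := θ)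
      (n1 0) (n1 2) (n1 10) (n1 7)
      (by rw [inner_hcpTuple 0 2, (by decide : sqNormInt (hcpVec 0 - hcpVec 2) = 18)]; norm_num)
      (by norm_num)
      (by rw [inner_hcpTuple 10 0, (by decide : sqNormInt (hcpVec 10 - hcpVec 0) = 18)]; norm_num)
      (by rw [inner_hcpTuple 10 2, (by decide : sqNormInt (hcpVec 10 - hcpVec 2) = 36)]; norm_num)
      (by norm_num)
      (by rw [inner_hcpTuple 10 7, inner_hcpTuple 7 0, inner_hcpTuple 7 2, (by decide : sqNormInt (hcpVec 10 - hcpVec 7) = 48), (by decide : sqNormInt (hcpVec 7 - hcpVec 0) = 18), (by decide : sqNormInt (hcpVec 7 - hcpVec 2) = 36)]; norm_num)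
      hθ0.le (by norm_num) (by norm_num) (by linarith)
      f0 f2 f7
      (hA5 _ (Or.inl rfl)) (hA5 _ (Or.inr (Or.inr (Or.inl rfl)))) (hA5 _ (Or.inr (Or.inr (Or.inr rfl))))
      (hNd (by decide : (10 : Fin 12) ≠ 7) (by decide))
    exact h.trans (le_of_eq (by norm_num))
  -- step 6: triangle {9,10,11}, new vertex 11, anchors 9 10, witness 0 (E = 162)
  obtain ⟨A6, hA6⟩ := hT ⟨hcpTuple 9, hcpTuple_mem 9⟩ ⟨hcpTuple 10, hcpTuple_mem 10⟩ ⟨hcpTuple 11, hcpTuple_mem 11⟩ (dist_hcpTuple_eq_one (by decide : sqNormInt (hcpVec 9 - hcpVec 10) = 18)) (dist_hcpTuple_eq_one (by decide : sqNormInt (hcpVec 10 - hcpVec 11) = 18)) (dist_hcpTuple_eq_one (by decide : sqNormInt (hcpVec 9 - hcpVec 11) = 18))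
  have f11 : ‖p ⟨hcpTuple 11, hcpTuple_mem 11⟩ - A (hcpTuple 11)‖ ≤ 678 * θ := by
    have h := placement_step hV A A6 (z₀ := hcpTuple 9) (z₁ := hcpTuple 10) (x := hcpTuple 11) (y := hcpTuple 0)
      (X := p ⟨hcpTuple 11, hcpTuple_mem 11⟩) (Y := p ⟨hcpTuple 0, hcpTuple_mem 0⟩) (P₀ := p ⟨hcpTuple 9, hcpTuple_mem 9⟩) (P₁ := p ⟨hcpTuple 10, hcpTuple_mem 10⟩)
      (κ := 1 / 2) (p := 1 / 3) (q := 1 / 3) (L := 11 / 3) (E := 162) (c := 18) (θ := θ)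
      (n1 9) (n1 10) (n1 11) (n1 0)
      (by rw [inner_hcpTuple 9 10, (by decide : sqNormInt (hcpVec 9 - hcpVec 10) = 18)]; norm_num)
      (by norm_num)
      (by rw [inner_hcpTuple 11 9, (by decide : sqNormInt (hcpVec 11 - hcpVec 9) = 18)]; norm_num)
      (by rw [inner_hcpTuple 11 10, (by decide : sqNormInt (hcpVec 11 - hcpVec 10) = 18)]; norm_num)
      (by norm_num)
      (by rw [inner_hcpTuple 11 0, inner_hcpTuple 0 9, inner_hcpTuple 0 10, (by decide : sqNormInt (hcpVec 11 - hcpVec 0) = 54), (by decide : sqNormInt (hcpVec 0 - hcpVec 9) = 36), (by decide : sqNormInt (hcpVec 0 - hcpVec 10) = 18)]; norm_num)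
      hθ0.le (by norm_num) (by norm_num) (by linarith)
      f9 f10 (weak f0 (by norm_num))
      (hA6 _ (Or.inl rfl)) (hA6 _ (Or.inr (Or.inl rfl))) (hA6 _ (Or.inr (Or.inr rfl)))
      (hNd (by decide : (11 : Fin 12) ≠ 0) (by decide))
    exact h.trans (le_of_eq (by norm_num))
  -- step 7: square {1,6,4,8}, new vertex 1, anchors 4 8, witness 6 (E = 150)
  obtain ⟨A7, hA7⟩ := hO ⟨hcpTuple 1, hcpTuple_mem 1⟩ ⟨hcpTuple 6, hcpTuple_mem 6⟩ ⟨hcpTuple 4, hcpTuple_mem 4⟩ ⟨hcpTuple 8, hcpTuple_mem 8⟩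
    (dist_hcpTuple_eq_sqrt_two (by decide : sqNormInt (hcpVec 1 - hcpVec 6) = 36)) (dist_hcpTuple_eq_one (by decide : sqNormInt (hcpVec 4 - hcpVec 1) = 18)) (dist_hcpTuple_eq_one (by decide : sqNormInt (hcpVec 4 - hcpVec 6) = 18)) (dist_hcpTuple_eq_one (by decide : sqNormInt (hcpVec 8 - hcpVec 1) = 18)) (dist_hcpTuple_eq_one (by decide : sqNormInt (hcpVec 8 - hcpVec 6) = 18)) (dist_hcpTuple_eq_sqrt_two (by decide : sqNormInt (hcpVec 4 - hcpVec 8) = 36))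
  have f1 : ‖p ⟨hcpTuple 1, hcpTuple_mem 1⟩ - A (hcpTuple 1)‖ ≤ 690 * θ := by
    have h := placement_step hV A A7 (z₀ := hcpTuple 4) (z₁ := hcpTuple 8) (x := hcpTuple 1) (y := hcpTuple 6)
      (X := p ⟨hcpTuple 1, hcpTuple_mem 1⟩) (Y := p ⟨hcpTuple 6, hcpTuple_mem 6⟩) (P₀ := p ⟨hcpTuple 4, hcpTuple_mem 4⟩) (P₁ := p ⟨hcpTuple 8, hcpTuple_mem 8⟩)
      (κ := 0) (p := 1 / 2) (q := 1 / 2) (L := 4) (E := 150) (c := 18) (θ := θ)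
      (n1 4) (n1 8) (n1 1) (n1 6)
      (by rw [inner_hcpTuple 4 8, (by decide : sqNormInt (hcpVec 4 - hcpVec 8) = 36)]; norm_num)
      (by norm_num)
      (by rw [inner_hcpTuple 1 4, (by decide : sqNormInt (hcpVec 1 - hcpVec 4) = 18)]; norm_num)
      (by rw [inner_hcpTuple 1 8, (by decide : sqNormInt (hcpVec 1 - hcpVec 8) = 18)]; norm_num)
      (by norm_num)
      (by rw [inner_hcpTuple 1 6, inner_hcpTuple 6 4, inner_hcpTuple 6 8, (by decide : sqNormInt (hcpVec 1 - hcpVec 6) = 36), (by decide : sqNormInt (hcpVec 6 - hcpVec 4) = 18), (by decide : sqNormInt (hcpVec 6 - hcpVec 8) = 18)]; norm_num)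
      hθ0.le (by norm_num) (by norm_num) (by linarith)
      f4 f8 (weak f6 (by norm_num))
      (hA7 _ (Or.inr (Or.inr (Or.inl rfl)))) (hA7 _ (Or.inr (Or.inr (Or.inr rfl)))) (hA7 _ (Or.inl rfl))
      (hNd (by decide : (1 : Fin 12) ≠ 6) (by decide))
    exact h.trans (le_of_eq (by norm_num))
  -- step 8: square {3,7,5,8}, new vertex 3, anchors 5 8, witness 7 (E = 150)
  obtain ⟨A8, hA8⟩ := hO ⟨hcpTuple 3, hcpTuple_mem 3⟩ ⟨hcpTuple 7, hcpTuple_mem 7⟩ ⟨hcpTuple 5, hcpTuple_mem 5⟩ ⟨hcpTuple 8, hcpTuple_mem 8⟩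
    (dist_hcpTuple_eq_sqrt_two (by decide : sqNormInt (hcpVec 3 - hcpVec 7) = 36)) (dist_hcpTuple_eq_one (by decide : sqNormInt (hcpVec 5 - hcpVec 3) = 18)) (dist_hcpTuple_eq_one (by decide : sqNormInt (hcpVec 5 - hcpVec 7) = 18)) (dist_hcpTuple_eq_one (by decide : sqNormInt (hcpVec 8 - hcpVec 3) = 18)) (dist_hcpTuple_eq_one (by decide : sqNormInt (hcpVec 8 - hcpVec 7) = 18)) (dist_hcpTuple_eq_sqrt_two (by decide : sqNormInt (hcpVec 5 - hcpVec 8) = 36))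
  have f3 : ‖p ⟨hcpTuple 3, hcpTuple_mem 3⟩ - A (hcpTuple 3)‖ ≤ 690 * θ := by
    have h := placement_step hV A A8 (z₀ := hcpTuple 5) (z₁ := hcpTuple 8) (x := hcpTuple 3) (y := hcpTuple 7)
      (X := p ⟨hcpTuple 3, hcpTuple_mem 3⟩) (Y := p ⟨hcpTuple 7, hcpTuple_mem 7⟩) (P₀ := p ⟨hcpTuple 5, hcpTuple_mem 5⟩) (P₁ := p ⟨hcpTuple 8, hcpTuple_mem 8⟩)
      (κ := 0) (p := 1 / 2) (q := 1 / 2) (L := 4) (E := 150) (c := 18) (θ := θ)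
      (n1 5) (n1 8) (n1 3) (n1 7)
      (by rw [inner_hcpTuple 5 8, (by decide : sqNormInt (hcpVec 5 - hcpVec 8) = 36)]; norm_num)
      (by norm_num)
      (by rw [inner_hcpTuple 3 5, (by decide : sqNormInt (hcpVec 3 - hcpVec 5) = 18)]; norm_num)
      (by rw [inner_hcpTuple 3 8, (by decide : sqNormInt (hcpVec 3 - hcpVec 8) = 18)]; norm_num)
      (by norm_num)
      (by rw [inner_hcpTuple 3 7, inner_hcpTuple 7 5, inner_hcpTuple 7 8, (by decide : sqNormInt (hcpVec 3 - hcpVec 7) = 36), (by decide : sqNormInt (hcpVec 7 - hcpVec 5) = 18), (by decide : sqNormInt (hcpVec 7 - hcpVec 8) = 18)]; norm_num)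
      hθ0.le (by norm_num) (by norm_num) (by linarith)
      f5 f8 (weak f7 (by norm_num))
      (hA8 _ (Or.inr (Or.inr (Or.inl rfl)))) (hA8 _ (Or.inr (Or.inr (Or.inr rfl)))) (hA8 _ (Or.inl rfl))
      (hNd (by decide : (3 : Fin 12) ≠ 7) (by decide))
    exact h.trans (le_of_eq (by norm_num))
  -- all twelve placed; worst error 690·θ
  refine ⟨A, fun z => ?_⟩
  obtain ⟨k, hk⟩ := exists_hcpTuple_eq z.2
  rw [hcp_subtype_eq hk]
  fin_cases k
  · exact weak f0 (by norm_num)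
  · exact f1
  · exact weak f2 (by norm_num)
  · exact f3
  · exact weak f4 (by norm_num)
  · exact weak f5 (by norm_num)
  · exact weak f6 (by norm_num)
  · exact weak f7 (by norm_num)
  · exact weak f8 (by norm_num)
  · exact weak f9 (by norm_num)
  · exact weak f10 (by norm_num)
  · exact weak f11 (by norm_num)

/-- **`FrameAssemblyAt 4796 18 hcpKissingPattern`** — the hcp frame assembly with explicit constants (walk below `θ = 1/2200`, trivial
bound above). [folklore] -/
theorem frameAssemblyAt_hcp : FrameAssemblyAt 4796 18 hcpKissingPattern := by
  have h := frameAssemblyAt_hcp_of_smallAngle (K₁ := 690) (c := 18) (θ₁ := 1 / 2200) (by norm_num) (by norm_num) ?_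
  · have e : max (690 : ℝ) ((2 + 18 / 100) / (1 / 2200)) = 4796 := by norm_num
    rw [e] at h
    exact h
  intro θ d hθ0 hθ1 _ hd p hT hO hN
  have hd' : d ≠ 0 := hd.ne'
  have hnd : ‖d⁻¹‖ = d⁻¹ := by rw [Real.norm_eq_abs, abs_of_pos (inv_pos.2 hd)]
  have hscale : ∀ {v : E3} {z : E3} {A : E3 →ₗᵢ[ℝ] E3} {a : ℝ}, ‖v - d • A z‖ ≤ a * θ * d → ‖d⁻¹ • v - A z‖ ≤ a * θ := by
    intro v z A a h
    have hv : d⁻¹ • v - A z = d⁻¹ • (v - d • A z) := by rw [smul_sub, smul_smul, inv_mul_cancel₀ hd', one_smul]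
    rw [hv, norm_smul, hnd]
    rw [← le_div_iff₀' (inv_pos.2 hd), div_inv_eq_mul]
    linarith [h]
  have hback : ∀ {v : E3} {z : E3} {A : E3 →ₗᵢ[ℝ] E3} {a : ℝ}, ‖d⁻¹ • v - A z‖ ≤ a * θ → ‖v - d • A z‖ ≤ a * θ * d := by
    intro v z A a h
    have hv : v - d • A z = d • (d⁻¹ • v - A z) := by rw [smul_sub, smul_smul, mul_inv_cancel₀ hd', one_smul]
    rw [hv, norm_smul, Real.norm_eq_abs, abs_of_pos hd]
    have := mul_le_mul_of_nonneg_left h hd.le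
    linarith [this]
  obtain ⟨A, hA⟩ := hcp_walk_unit hθ0 hθ1 (fun z => d⁻¹ • p z)
    (fun u w x h1 h2 h3 => by
      obtain ⟨A, h⟩ := hT u w x h1 h2 h3
      exact ⟨A, fun z hz => hscale (h z hz)⟩)
    (fun u v w w' h1 h2 h3 h4 h5 h6 => by
      obtain ⟨A, h⟩ := hO u v w w' h1 h2 h3 h4 h5 h6
      exact ⟨A, fun z hz => hscale (h z hz)⟩)
    (fun u v huv hd1 => by
      have h := hN u v huv hd1
      rw [dist_smul₀, hnd, inv_mul_eq_div]
      exact (one_le_div hd).2 h)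
  exact ⟨A, fun z => hback (hA z)⟩

end Summit.AtomisticToContinuum.Crystallization.Theorems.FrustratedLawDichotomyTwoShellRigidityHcpWalk

end
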